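import Mathlib
import HarnessLib
import Literature.Combinatorics.Additive.KempermanElementaryPairs
import Literature.Combinatorics.Additive.KempermanStructureTheorem
import Literature.Combinatorics.Additive.CriticalSumProgressionOrQuasiPeriodic
import Literature.Combinatorics.Additive.PuncturedGroupCriticalPairs
import Literature.Combinatorics.Additive.KempermanDecompositionLift

/-!
# The Kemperman Structure Theorem, «only if» half (Kemperman 1960, Theorem 5.1, necessity):
# aperiodic sums

[cite: Kemperman1960, Thm 5.1] [tag: critical-pair] [tag: inverse-theorem]

Topic `Literature/Combinatorics/Additive`.  Cell `mm-stpp` (D-0046), seat `mm-stpp-lit` (gen 22): the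
bridge from the tree's Boothby–DeVos–Montejano form of Kemperman's theorem (`kemperman_structure_step`,
`KempermanStructures.lean`) to the quasi-periodic form of Kemperman 1960 / Grynkiewicz 2005
(`IsKempermanDecompI` of `KempermanElementaryPairs.lean`), for pairs with APERIODIC sum — the
branch of Theorem 5.1 used by Grynkiewicz 2009 Lemma 5.9 / Theorem 4.1.  Built on
`PuncturedGroupCriticalPairs.lean` (the bottom case), `KempermanDecompositionLift.lean` (the
inductive step) and `CriticalSumProgressionOrQuasiPeriodic.lean` (the walking technique).

SOURCE.  J. H. B. Kemperman, *On small sumsets in an abelian group*, Acta Math. **103** (1960)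
63–88, §5, THEOREM 5.1 (pp. 78–79 = p0016 L60–p0017 L22 of the held text
`paper:doi-10-1007-bf02546525`), necessity, for `A + B` aperiodic; D. J. Grynkiewicz,
*Quasi-periodic decompositions and the Kemperman structure theorem*, European J. Combin. 26 (2005),
§2 «KST I».  The proof here is NOT Kemperman's (`P(A, B)`, Lemmas 4.4–4.6, 5.2): it walks the
classification of T. Boothby, M. DeVos, A. Montejano, *A new proof of Kemperman's theorem*, Integers 15
(2015) #A5, arXiv:1301.0095, Thm 4.5, as formalized in `KempermanStructureTheorem.lean`.

MAIN RESULTS (0 named facts; everything PROVED).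
* `exists_isKempermanDecompI_of_not_isPeriodic` — `G` finite nontrivial, `A, B ≠ ∅`,
  `|A + B| = |A| + |B| − 1`, `A + B` aperiodic ⟹ `∃ H A₁ A₀ B₁ B₀, IsKempermanDecompI H A B A₁ A₀ B₁ B₀`;
  primed version with `|A + B| ≤ |A| + |B| − 1`.
* Transport `↥H' → G`: `addConvolution_toSub`, `isPeriodic_of_toSub`, `isPeriodic_toSub`,
  `IsQuasiPeriodicDecomp.of_toSub`, `cosetCount_map_subtype`, `IsElementaryPair.of_toSub`,
  `IsKempermanDecompI.of_toSub`.

PROOF.  The pair property `KP(X, Y)` := «(2) for `(X, Y)` ⟹ `(X, Y)` has a decomposition (i)–(iv)»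
is symmetric and translation invariant, hence invariant under the similarities of
Boothby–DeVos–Montejano; we prove by strong induction on `|G|` that all three pairs of a maximal trio
of deficiency `1` with nonempty members have it (`trioKP_of_isMaximalTrio`).  By
`kemperman_structure_step` the trio is, relative to a proper subgroup `H`:
* a pure beat — then `H = {0}` (deficiency `|H| = 1`) and in normal position the trio is
  `({0}, B, C)` with `B + C = G ∖ {0}`: `({0}, B)`, `(C, {0})` are of type (I) and `(B, C)` is the
  punctured-group pair (`exists_isKempermanDecompI_of_add_eq_univ_erase`);
* a pure chord — `H = {0}`, all members are progressions with the generating difference `r`, all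
  pairs are of type (I)/(II) (`isElementaryPair_of_isAP`);
* an impure beat rel. `H` (`|H| ≥ 2`): in normal position `A ⊆ H`, `B ∖ H`, `C ∖ H` are `H`-periodic;
  each pair has COARSE DATA relative to `H` (Kemperman's `P₁` of norm one) whose bottom pair is a
  pair of the continuation `(A, B ∩ H, C ∩ H)` — a maximal trio of deficiency `1` in `H`, which has
  the pair property by induction (transported from `↥H` by `IsKempermanDecompI.of_toSub`) —, and
  `exists_isKempermanDecompI_of_coarse_of_imp` (lift + inheritance of (2), with the type (I) escape)
  concludes: `kp_of_subset_carrier` for `(A, B)`, `(A, C)`; `kp_of_outer_pair` for `(B, C)`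
  (`B + C = −Ā`, outside `H`: `c ∈ C ↔ −c ∉ B ∖ H`; counts via `|φ(X)| + |φ(X̄)| = |φ(G)|`);
* an impure chord rel. `H`: `H ∪ A`, `H ∪ B` are `R`-sequences of `m`, `n` terms, `m + n − 2 < t =
  [G : H]`, `(A + B) ∖ H = rseq H r r (m+n−2)`, `C ∖ H = −\overline{rseq H r r (m+n−2) ∪ H}`; sums in
  `H` come only from the parts in `H` (`i + j < t`), and the coset counts are `m + n − 1 = m + n − 1`
  (`kp_chord_inner`) and `t − m + 1 + 1 = n + (t − m − n + 2)` (`kp_chord_outer`); the bottom pairs are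
  the pairs of the continuation `(A ∩ H, B ∩ H, C ∩ H)`, induction as before.
Finally an aperiodic critical pair is pure, so `(A, B, \overline{−(A+B)})` is a maximal trio of
deficiency `1` (`purePair_critical_iff_maximalTrio`) and `KP(A, B)` applies with hypothesis (2).

## References
* J. H. B. Kemperman, *On small sumsets in an abelian group*, Acta Math. 103 (1960) 63–88,
  doi:10.1007/BF02546525, §5 Theorem 5.1 (pp. 78–81) — held `paper:doi-10-1007-bf02546525`,
  p0016–p0019 read 2026-08-29 [cite: Kemperman1960, Thm 5.1].
* D. J. Grynkiewicz, *Quasi-periodic decompositions and the Kemperman structure theorem*, European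
  J. Combin. 26 (2005) 559–575, §2 (KST I) — held `paper:doi-10-1016-j-ejc-2004-06-011`, p0007
  [cite: Grynkiewicz2005, §2].
* T. Boothby, M. DeVos, A. Montejano, *A new proof of Kemperman's theorem*, Integers 15 (2015) #A5,
  arXiv:1301.0095, §4 Theorem 4.5 [cite: BoothbyDevosMontejano2013, Thm 4.5].
* D. J. Grynkiewicz, *A step beyond Kemperman's structure theorem*, Mathematika 55 (2009) 67–114, §2
  (KST as used there) [cite: Grynkiewicz2009, §2].
-/

namespace Literature.Combinatorics.Additive

open Finset
open scoped Pointwise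

universe u

section General

variable {G : Type*} [AddCommGroup G] [DecidableEq G]

/-! ### The pair property carried along the chain -/

/-- «If `(X, Y)` satisfies Kemperman's hypothesis (2) — `X + Y` aperiodic or with a unique expression
element — then it admits a decomposition (i)–(iv)» (private shorthand). [cite: Kemperman1960, Thm 5.1] -/
private def KP (X Y : Finset G) : Prop :=
  (¬ IsPeriodic (X + Y) ∨ ∃ c, X.addConvolution Y c = 1) →
    ∃ (L : AddSubgroup G) (X₁ X₀ Y₁ Y₀ : Finset G), IsKempermanDecompI L X Y X₁ X₀ Y₁ Y₀

/-- `KP` is symmetric. [cite: Kemperman1960, Thm 5.1] -/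
private theorem kp_symm {X Y : Finset G} (h : KP X Y) : KP Y X := by
  intro hyp
  have hyp' : ¬ IsPeriodic (X + Y) ∨ ∃ c, X.addConvolution Y c = 1 := by
    rcases hyp with h1 | ⟨c, hc⟩
    · rw [add_comm] at h1; exact Or.inl h1
    · exact Or.inr ⟨c, by rw [Grynkiewicz2009.addConvolution_comm]; exact hc⟩
  obtain ⟨L, X₁, X₀, Y₁, Y₀, hd⟩ := h hyp'
  exact ⟨L, Y₁, Y₀, X₁, X₀, hd.symm⟩

/-- `KP` is translation invariant. [cite: Kemperman1960, Thm 5.1] -/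
private theorem kp_vadd {X Y : Finset G} (h : KP X Y) (s t : G) : KP (s +ᵥ X) (t +ᵥ Y) := by
  intro hyp
  have e : (s +ᵥ X) + (t +ᵥ Y) = (s + t) +ᵥ (X + Y) := by
    rw [vadd_add_assoc, add_comm X (t +ᵥ Y), vadd_add_assoc, vadd_vadd, add_comm Y X]
  have hyp' : ¬ IsPeriodic (X + Y) ∨ ∃ c, X.addConvolution Y c = 1 := by
    rcases hyp with h1 | ⟨c, hc⟩
    · rw [e, isPeriodic_vadd_iff] at h1; exact Or.inl h1
    · rw [addConvolution_vadd_vadd] at hc; exact Or.inr ⟨_, hc⟩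
  obtain ⟨L, X₁, X₀, Y₁, Y₀, hd⟩ := h hyp'
  exact ⟨L, _, _, _, _, hd.vadd s t⟩

/-- An elementary pair has `KP` (with quasi-period `G`). [cite: Kemperman1960, Thm 5.1] -/
private theorem kp_of_isElementaryPair {X Y : Finset G} (hG : (⊤ : AddSubgroup G) ≠ ⊥)
    (h : IsElementaryPair X Y) : KP X Y := fun _ =>
  ⟨⊤, ∅, X, ∅, Y, h.isKempermanDecompI_top hG⟩

/-- The pair property of a triple: `KP` for the three pairs. [cite: Kemperman1960, Thm 5.1] -/
private def TrioKP (A B C : Finset G) : Prop := KP A B ∧ KP B C ∧ KP C A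

/-- Invariance under rotation. [cite: Kemperman1960, Thm 5.1] -/
private theorem trioKP_rotate {A B C : Finset G} (h : TrioKP A B C) : TrioKP B C A :=
  ⟨h.2.1, h.2.2, h.1⟩

/-- Invariance under swapping. [cite: Kemperman1960, Thm 5.1] -/
private theorem trioKP_swap {A B C : Finset G} (h : TrioKP A B C) : TrioKP B A C :=
  ⟨kp_symm h.1, kp_symm h.2.2, kp_symm h.2.1⟩

/-- Invariance under `(A + g, B − g, C)`. [cite: BoothbyDevosMontejano2013, §4] -/
private theorem trioKP_translate {A B C : Finset G} (g : G) (h : TrioKP A B C) :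
    TrioKP (g +ᵥ A) (-g +ᵥ B) C := by
  obtain ⟨h1, h2, h3⟩ := h
  refine ⟨kp_vadd h1 g (-g), ?_, ?_⟩
  · have := kp_vadd h2 (-g) 0
    rwa [zero_vadd] at this
  · have := kp_vadd h3 0 g
    rwa [zero_vadd] at this

/-- The pair property transports along similarity. [cite: BoothbyDevosMontejano2013, §4] -/
private theorem Similar.trioKP {T U : Finset G × Finset G × Finset G} (h : Similar T U)
    (hT : TrioKP T.1 T.2.1 T.2.2) : TrioKP U.1 U.2.1 U.2.2 := by
  induction h with
  | refl => exact hT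
  | rotate _ ih => exact trioKP_rotate ih
  | swap _ ih => exact trioKP_swap ih
  | translate g _ ih => exact trioKP_translate g ih

/-! ### Generic helpers -/

omit [DecidableEq G] in
/-- `G` is a nontrivial group as soon as it has two elements. [cite: Kemperman1960, §5] -/
private theorem top_ne_bot_of_two_le [Fintype G] (h2 : 2 ≤ Fintype.card G) :
    (⊤ : AddSubgroup G) ≠ ⊥ := by
  intro h
  obtain ⟨x, y, hxy⟩ := Fintype.one_lt_card_iff.1 (by omega : 1 < Fintype.card G)
  have hx : x ∈ (⊤ : AddSubgroup G) := AddSubgroup.mem_top x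
  have hy : y ∈ (⊤ : AddSubgroup G) := AddSubgroup.mem_top y
  rw [h, AddSubgroup.mem_bot] at hx hy
  exact hxy (by rw [hx, hy])

/-- Members of a maximal trio of deficiency one: `|A| + |B| + |C| = |G| + 1`.
[cite: BoothbyDevosMontejano2013, Def 3.2] -/
private theorem card_add_card_add_card {G : Type*} [Fintype G] {A B C : Finset G} (hδ : trioDeficiency A B C = 1) :
    #A + #B + #C = Fintype.card G + 1 := by
  unfold trioDeficiency at hδ
  omega

/-- For a maximal trio, `|X + Y| + |Z| = |G|` for each two members. [cite: BoothbyDevosMontejano2013, §3] -/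
private theorem card_add_add_card [Fintype G] {A B C : Finset G} (h : IsMaximalTrio A B C) :
    #(A + B) + #C = Fintype.card G := by
  rw [(isMaximalTrio_iff.1 h).1, add_comm, card_third_add_card_add]

/-- Two members of a deficiency-one maximal trio form a critical pair: `|X + Y| + 1 = |X| + |Y|`.
[cite: Kemperman1960, §5] [cite: BoothbyDevosMontejano2013, §3] -/
private theorem card_add_succ [Fintype G] {A B C : Finset G} (h : IsMaximalTrio A B C)
    (hδ : trioDeficiency A B C = 1) : #(A + B) + 1 = #A + #B := by
  have h1 := card_add_card_add_card hδ
  have h2 := card_add_add_card h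
  omega

/-- In a cyclic group `⟨r⟩ = G`, two nonempty progressions with difference `r` of total size at most
`|G| + 1` form an elementary pair of type (I) or (II). [cite: Kemperman1960, §5 (types (I), (II))] -/
private theorem isElementaryPair_of_isAP [Fintype G] {X Y : Finset G} {r : G}
    (hr : AddSubgroup.zmultiples r = ⊤) (hX : IsAP X r) (hY : IsAP Y r) (hXne : X.Nonempty)
    (hYne : Y.Nonempty) (hle : #X + #Y ≤ Fintype.card G + 1) : IsElementaryPair X Y := by
  by_cases h1 : #X = 1 ∨ #Y = 1
  · exact Or.inl ⟨hXne, hYne, h1⟩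
  · right; left
    have hx := hXne.card_pos
    have hy := hYne.card_pos
    refine ⟨by omega, by omega, r, hX, hY, Or.inr ?_⟩
    have hord : addOrderOf r = Fintype.card G := by
      rw [← Nat.card_zmultiples, hr, AddSubgroup.card_top, Nat.card_eq_fintype_card]
    rw [hord]; omega

end General

section Pure

variable {G : Type*} [AddCommGroup G] [Fintype G] [DecidableEq G]

/-- A pure beat relative to the trivial subgroup, `({0}, B, C)` with `B + C = G ∖ {0}`: the pairs
`({0}, B)`, `(C, {0})` are of type (I), and `(B, C)` is the punctured-group pair of
`PuncturedGroupCriticalPairs.lean`. [cite: Kemperman1960, Lemma 5.2 (proof, case (ii))]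
[cite: BoothbyDevosMontejano2013, Def 4.1] -/
private theorem trioKP_of_isPureBeatAt {A B C : Finset G} (h : IsPureBeatAt ({0} : Finset G) A B C)
    (hδ : trioDeficiency A B C = 1) (hB : B.Nonempty) : TrioKP A B C := by
  have hH : IsSubgroupCarrier ({0} : Finset G) := by
    refine IsSubgroupCarrier.of_coe_eq (⊥ : AddSubgroup G) ?_
    rw [coe_singleton, AddSubgroup.coe_bot]
  have hmax := (h.isMaximalTrio hH).1
  obtain ⟨hA, -, -, hC⟩ := h
  have hBC : B + C = univ.erase 0 := by
    rw [hmax.add_eq_neg_compl, hA]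
    ext x
    simp [mem_neg', mem_compl]
  have h2G : 2 ≤ Fintype.card G := by
    have h1 := card_add_add_card hmax.rotate
    have h2 : 0 < #(B + C) := (hB.add hC).card_pos
    rw [hA, card_singleton] at h1
    omega
  have hG := top_ne_bot_of_two_le h2G
  have hAne : A.Nonempty := by rw [hA]; exact singleton_nonempty 0
  have hA1 : #A = 1 := by rw [hA, card_singleton]
  refine ⟨kp_of_isElementaryPair hG (Or.inl ⟨hAne, hB, Or.inl hA1⟩), fun _ => ?_,
    kp_of_isElementaryPair hG (Or.inl ⟨hC, hAne, Or.inr hA1⟩)⟩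
  have hcrit : #(B + C) + 1 ≤ #B + #C := by
    have := card_add_succ hmax.rotate (by rw [trioDeficiency_rotate]; exact hδ)
    omega
  exact exists_isKempermanDecompI_of_add_eq_univ_erase hB hC hBC hcrit

/-- A pure chord relative to the trivial subgroup: all members are progressions with the generating
difference `r`, so all three pairs are elementary of type (I) or (II).
[cite: Kemperman1960, Lemma 5.2 (proof: «from Lemma 4.3, (A, B) is elementary of type (II)»)]
[cite: BoothbyDevosMontejano2013, Def 4.2] -/
private theorem trioKP_of_isPureChordAt {A B C : Finset G} {r : G}
    (h : IsPureChordAt ({0} : Finset G) r A B C) (hδ : trioDeficiency A B C = 1) (hC : C.Nonempty) :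
    TrioKP A B C := by
  have hH : IsSubgroupCarrier ({0} : Finset G) := by
    refine IsSubgroupCarrier.of_coe_eq (⊥ : AddSubgroup G) ?_
    rw [coe_singleton, AddSubgroup.coe_bot]
  have hmax := (h.isMaximalTrio hH).1
  have htop := zmultiples_eq_top_of_isCyclicQuotGen h.1
  obtain ⟨a, b, m, n, hm, hn, hA, hB, hsum, -, hcA, hcB, hcAB⟩ := h.card_eq hH
  rw [card_singleton, mul_one] at hcA hcB hcAB
  rw [rseq_singleton_zero] at hA hB hsum
  have hAP : IsAP A r := ⟨a, by rw [hcA]; exact hA⟩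
  have hBP : IsAP B r := ⟨b, by rw [hcB]; exact hB⟩
  have hABP : IsAP (A + B) r := ⟨a + b, by rw [hcAB]; exact hsum⟩
  have hCP : IsAP C r := by
    rw [(isMaximalTrio_iff.1 hmax).1, third]
    exact (hABP.neg).compl_of_zmultiples_eq_top htop
  have hAne : A.Nonempty := card_pos.1 (by omega)
  have hBne : B.Nonempty := card_pos.1 (by omega)
  have hsum3 := card_add_card_add_card hδ
  have h2G : 2 ≤ Fintype.card G := le_trans (by omega : 2 ≤ #A) (card_le_univ A)
  have hG := top_ne_bot_of_two_le h2G
  refine ⟨kp_of_isElementaryPair hG (isElementaryPair_of_isAP htop hAP hBP hAne hBne (by omega)),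
    kp_of_isElementaryPair hG (isElementaryPair_of_isAP htop hBP hCP hBne hC (by omega)),
    kp_of_isElementaryPair hG (isElementaryPair_of_isAP htop hCP hAP hC hAne (by omega))⟩

end Pure

section Coarse

variable {G : Type*} [AddCommGroup G] [DecidableEq G] {H' : AddSubgroup G} {Hf : Finset G}

/-- A nonempty subset of `H` is absorbed by `H`-periodic sets: `X + Z = Z`. [cite: Kemperman1960, §5] -/
private theorem add_eq_of_subset_carrier (hHf : ∀ g, g ∈ Hf ↔ g ∈ H') {X Z : Finset G} (hX : X ⊆ Hf)
    (hXne : X.Nonempty) (hZ : IsPeriodicWith H' Z) : X + Z = Z := by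
  refine Subset.antisymm ?_ ?_
  · intro y hy
    obtain ⟨x, hx, z, hz, rfl⟩ := mem_add.1 hy
    exact hZ.add_mem ((hHf x).1 (hX hx)) hz
  · intro z hz
    obtain ⟨x, hx⟩ := hXne
    refine mem_add.2 ⟨x, hx, -x + z, hZ.add_mem (H'.neg_mem ((hHf x).1 (hX hx))) hz, by abel⟩

/-- `|φ_H(X)| + |φ_H(G ∖ X)| = |φ_H(G)|` for an `H`-periodic `X`. [cite: Kemperman1960, §5] -/
private theorem cosetCount_add_compl [Fintype G] {X : Finset G} (hX : IsPeriodicWith H' X) :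
    cosetCount H' X + cosetCount H' Xᶜ = cosetCount H' (univ : Finset G) := by
  rw [← cosetCount_union, union_compl]
  intro x hx y hy hxy
  rw [mem_compl] at hy
  refine hy ?_
  have := hX.add_mem (H'.neg_mem hxy) hx
  rwa [neg_sub, sub_add_cancel] at this

/-- `\overline{−X} ∖ H = −\overline{(X ∖ H) ∪ H}`. [cite: BoothbyDevosMontejano2013, §4] -/
private theorem compl_neg_sdiff_carrier [Fintype G] {H : Finset G} (hH : IsSubgroupCarrier H)
    (X : Finset G) : (-X)ᶜ \ H = -((X \ H) ∪ H)ᶜ := by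
  rw [sdiff_union_self_eq_union]
  ext x
  simp only [mem_sdiff, mem_neg', mem_compl, mem_union, not_or]
  constructor
  · rintro ⟨h1, h2⟩; exact ⟨h1, fun h3 => h2 (by simpa using hH.neg_mem h3)⟩
  · rintro ⟨h1, h2⟩; exact ⟨h1, fun h3 => h2 (hH.neg_mem h3)⟩

/-- **The pair with one member inside `H`** (impure beat, pairs `(A, B)` and `(A, C)`): coarse data
`X = ∅ ⊔ X`, `Y = (Y ∖ H) ⊔ (Y ∩ H)`, bottom pair `(X, Y ∩ H)` = the continuation pair.
[cite: Kemperman1960, Thm 5.1 (proof)] [cite: BoothbyDevosMontejano2013, Def 4.3] -/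
private theorem kp_of_subset_carrier (hHf : ∀ g, g ∈ Hf ↔ g ∈ H') (hH'b : H' ≠ ⊥) {X Y : Finset G}
    (hX : X ⊆ Hf) (hXne : X.Nonempty) (hY1 : IsPeriodicWith H' (Y \ Hf)) (hY0 : (Y ∩ Hf).Nonempty)
    (hk : KP X (Y ∩ Hf)) : KP X Y := by
  have memH : ∀ {x}, x ∈ Hf → x ∈ H' := fun hx => (hHf _).1 hx
  have hdA : IsQuasiPeriodicDecomp H' X ∅ X :=
    ⟨hH'b, disjoint_empty_left X, empty_union X, fun h _ => by rw [vadd_finset_empty],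
      fun x hx y hy => H'.sub_mem (memH (hX hx)) (memH (hX hy))⟩
  have hdB : IsQuasiPeriodicDecomp H' Y (Y \ Hf) (Y ∩ Hf) :=
    ⟨hH'b, disjoint_sdiff_inter Y Hf, sdiff_union_inter Y Hf, hY1,
      fun x hx y hy => H'.sub_mem (memH (mem_inter.1 hx).2) (memH (mem_inter.1 hy).2)⟩
  intro hyp
  refine exists_isKempermanDecompI_of_coarse_of_imp hHf hdA hdB hXne hY0 ?_ ?_ hk hyp
  · intro a ha b _ a' ha' b' hb' hq
    have h1 : a - a' ∈ H' := H'.sub_mem (memH (hX ha)) (memH (hX ha'))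
    refine ⟨h1, ?_⟩
    have e : b - b' = (a + b - (a' + b')) - (a - a') := by abel
    rw [e]; exact H'.sub_mem hq h1
  · have e1 : X + (Y \ Hf) = Y \ Hf := add_eq_of_subset_carrier hHf hX hXne hY1
    have e2 : X + Y = (Y \ Hf) ∪ (X + (Y ∩ Hf)) := by
      conv_lhs => rw [← sdiff_union_inter Y Hf]
      rw [add_union, e1]
    have hin : ∀ z ∈ X + (Y ∩ Hf), z ∈ Hf := by
      intro z hz
      obtain ⟨x, hx, y, hy, rfl⟩ := mem_add.1 hz
      exact (hHf _).2 (H'.add_mem (memH (hX hx)) (memH (mem_inter.1 hy).2))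
    have c1 : cosetCount H' (X + Y) = cosetCount H' (Y \ Hf) + 1 := by
      rw [e2, cosetCount_union, cosetCount_eq_one_of_sub_mem (hXne.add hY0)
        (fun x hx y hy => H'.sub_mem (memH (hin x hx)) (memH (hin y hy)))]
      intro p hp c hc hpc
      exact (mem_sdiff.1 hp).2 ((hHf p).2 (by
        have := H'.add_mem hpc (memH (hin c hc)); rwa [sub_add_cancel] at this))
    have c2 : cosetCount H' X = 1 :=
      cosetCount_eq_one_of_sub_mem hXne fun x hx y hy => H'.sub_mem (memH (hX hx)) (memH (hX hy))
    rw [c1, c2, hdB.cosetCount_eq hY0]; ring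

/-- **The pair with both members sticking out of `H`** (impure beat, pair `(B, C)`): `B + C = −Ā`
with `A ⊆ H`, coarse data `B = (B ∖ H) ⊔ (B ∩ H)`, `C = (C ∖ H) ⊔ (C ∩ H)`, and outside `H`:
`c ∈ C ↔ −c ∉ B ∖ H`. Bottom pair = the continuation pair `(B ∩ H, C ∩ H)`.
[cite: Kemperman1960, Thm 5.1 (proof)] [cite: BoothbyDevosMontejano2013, Def 4.3] -/
private theorem kp_of_outer_pair [Fintype G] (hHf : ∀ g, g ∈ Hf ↔ g ∈ H') (hH'b : H' ≠ ⊥)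
    {A B C : Finset G} (hA : A ⊆ Hf) (hBC : B + C = -Aᶜ)
    (hB1 : IsPeriodicWith H' (B \ Hf)) (hB0 : (B ∩ Hf).Nonempty)
    (hC1 : IsPeriodicWith H' (C \ Hf)) (hC0 : (C ∩ Hf).Nonempty)
    (hCiff : ∀ x, x ∉ Hf → (x ∈ C ↔ -x ∉ B \ Hf)) (hk : KP (B ∩ Hf) (C ∩ Hf)) : KP B C := by
  have memH : ∀ {x}, x ∈ Hf → x ∈ H' := fun hx => (hHf _).1 hx
  have hHper : IsPeriodicWith H' Hf := isPeriodicWith_carrier hHf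
  have hdB : IsQuasiPeriodicDecomp H' B (B \ Hf) (B ∩ Hf) :=
    ⟨hH'b, disjoint_sdiff_inter B Hf, sdiff_union_inter B Hf, hB1,
      fun x hx y hy => H'.sub_mem (memH (mem_inter.1 hx).2) (memH (mem_inter.1 hy).2)⟩
  have hdC : IsQuasiPeriodicDecomp H' C (C \ Hf) (C ∩ Hf) :=
    ⟨hH'b, disjoint_sdiff_inter C Hf, sdiff_union_inter C Hf, hC1,
      fun x hx y hy => H'.sub_mem (memH (mem_inter.1 hx).2) (memH (mem_inter.1 hy).2)⟩
  intro hyp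
  refine exists_isKempermanDecompI_of_coarse_of_imp hHf hdB hdC hB0 hC0 ?_ ?_ hk hyp
  · intro b hb c hc b' hb' c' hc' hq
    have hb'H := memH (mem_inter.1 hb').2
    have hc'H := memH (mem_inter.1 hc').2
    have hbc : b + c ∈ H' := by
      have := H'.add_mem hq (H'.add_mem hb'H hc'H); rwa [sub_add_cancel] at this
    have hbH : b ∈ Hf := by
      by_contra hbH
      have hcH : c ∉ Hf := fun hcH => hbH ((hHf b).2 (by
        have := H'.sub_mem hbc (memH hcH); rwa [add_sub_cancel_right] at this))
      refine ((hCiff c hcH).1 hc) ?_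
      -- `−c = −(b + c) + b ∈ B ∖ H`
      have := hB1.add_mem (H'.neg_mem hbc) (mem_sdiff.2 ⟨hb, hbH⟩)
      rwa [neg_add_rev, add_assoc, neg_add_cancel, add_zero] at this
    have hbH' := memH hbH
    have hcH' : c ∈ H' := by
      have := H'.sub_mem hbc hbH'; rwa [add_sub_cancel_left] at this
    exact ⟨H'.sub_mem hbH' hb'H, H'.sub_mem hcH' hc'H⟩
  · -- the count
    have hAc : ((Hf \ A) : Finset G).Nonempty := by
      obtain ⟨x, hx⟩ := hB0.add hC0
      obtain ⟨b, hb, c, hc, rfl⟩ := mem_add.1 hx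
      have hin : b + c ∈ Hf := (hHf _).2 (H'.add_mem (memH (mem_inter.1 hb).2) (memH (mem_inter.1 hc).2))
      have hsum : b + c ∈ B + C := add_mem_add (mem_inter.1 hb).1 (mem_inter.1 hc).1
      rw [hBC, mem_neg', mem_compl] at hsum
      refine ⟨-(b + c), mem_sdiff.2 ⟨(hHf _).2 (H'.neg_mem (memH hin)), hsum⟩⟩
    have c1 : cosetCount H' (B + C) = cosetCount H' Hfᶜ + 1 := by
      rw [hBC, cosetCount_neg]
      have e : Aᶜ = Hfᶜ ∪ (Hf \ A) := by
        ext x; simp only [mem_compl, mem_union, mem_sdiff]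
        constructor
        · intro h; by_cases hx : x ∈ Hf; exacts [Or.inr ⟨hx, h⟩, Or.inl hx]
        · rintro (h | h); exacts [fun hx => h (hA hx), h.2]
      rw [e, cosetCount_union, cosetCount_eq_one_of_sub_mem hAc fun x hx y hy =>
        H'.sub_mem (memH (mem_sdiff.1 hx).1) (memH (mem_sdiff.1 hy).1)]
      intro x hx y hy hxy
      rw [mem_compl] at hx
      exact hx ((hHf x).2 (by
        have := H'.add_mem hxy (memH (mem_sdiff.1 hy).1); rwa [sub_add_cancel] at this))
    have c2 := cosetCount_add_compl hHper
    rw [cosetCount_eq_one_of_sub_mem ⟨0, (hHf 0).2 H'.zero_mem⟩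
      (fun x hx y hy => H'.sub_mem (memH hx) (memH hy))] at c2
    have hUper : IsPeriodicWith H' (-(B \ Hf) ∪ Hf) := hB1.neg.union hHper
    have c3 := cosetCount_add_compl hUper
    have c4 : cosetCount H' (-(B \ Hf) ∪ Hf) = cosetCount H' (B \ Hf) + 1 := by
      rw [cosetCount_union, cosetCount_neg, cosetCount_eq_one_of_sub_mem ⟨0, (hHf 0).2 H'.zero_mem⟩
        (fun x hx y hy => H'.sub_mem (memH hx) (memH hy))]
      intro x hx y hy hxy
      rw [mem_neg'] at hx
      have hxH : x ∈ Hf := (hHf x).2 (by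
        have := H'.add_mem hxy (memH hy); rwa [sub_add_cancel] at this)
      exact (mem_sdiff.1 hx).2 ((hHf _).2 (H'.neg_mem (memH hxH)))
    have c5 : C \ Hf = (-(B \ Hf) ∪ Hf)ᶜ := by
      ext x
      rw [mem_sdiff, mem_compl, mem_union, not_or, mem_neg']
      constructor
      · rintro ⟨hxC, hxH⟩; exact ⟨(hCiff x hxH).1 hxC, hxH⟩
      · rintro ⟨h1, h2⟩; exact ⟨(hCiff x h2).2 h1, h2⟩
    rw [c1, hdB.cosetCount_eq hB0, hdC.cosetCount_eq hC0, c5]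
    omega

end Coarse

section ImpureBeat

variable {G : Type*} [AddCommGroup G] [Fintype G] [DecidableEq G]

/-- The pair property for an impure beat in normal position relative to `H` (`|H| ≥ 2`), from the
pair property of its continuation `(A, B ∩ H, C ∩ H)`. [cite: Kemperman1960, Thm 5.1 (proof)]
[cite: BoothbyDevosMontejano2013, Def 4.3; Thm 4.5] -/
private theorem trioKP_of_isImpureBeatAt {H A B C : Finset G} (hH : IsSubgroupCarrier H)
    (h2H : 2 ≤ #H) (h : IsImpureBeatAt H A B C) (hmax : IsMaximalTrio A B C) (hAne : A.Nonempty)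
    (ih : TrioKP A (B ∩ H) (C ∩ H)) : TrioKP A B C := by
  set H' : AddSubgroup G := hH.toAddSubgroup
  have hHf : ∀ g, g ∈ H ↔ g ∈ H' := fun g => hH.mem_toAddSubgroup.symm
  have hH'b : H' ≠ ⊥ := by
    intro hbot
    have hsub : H ⊆ {0} := fun x hx => by
      have := (hHf x).1 hx
      rw [hbot, AddSubgroup.mem_bot] at this
      exact mem_singleton.2 this
    have := card_le_card hsub
    rw [card_singleton] at this
    omega
  have hAH : A ⊆ H := h.1
  have hB1 : IsPeriodicWith H' (B \ H) := (isPeriodicWith_iff_add_eq hHf).2 h.2.2.1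
  have hsd : (A + B) \ H = B \ H := h.add_sdiff_eq hH hAne
  have hC1 : IsPeriodicWith H' (C \ H) := by
    rw [h.2.2.2.1, third, compl_neg_sdiff_carrier hH, hsd]
    exact ((hB1.union (isPeriodicWith_carrier hHf)).compl).neg
  have hCiff : ∀ x, x ∉ H → (x ∈ C ↔ -x ∉ B \ H) := by
    intro x hxH
    have hnx : -x ∉ H := fun h' => hxH (by simpa using hH.neg_mem h')
    have hxC : x ∈ C ↔ x ∈ C \ H := by
      rw [mem_sdiff]; exact ⟨fun hc => ⟨hc, hxH⟩, fun hc => hc.1⟩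
    rw [hxC, h.2.2.2.1, mem_sdiff, third, mem_compl, mem_neg']
    constructor
    · rintro ⟨h1, -⟩ h2
      rw [← hsd, mem_sdiff] at h2
      exact h1 h2.1
    · intro h1
      refine ⟨fun h2 => h1 ?_, hxH⟩
      rw [← hsd]; exact mem_sdiff.2 ⟨h2, hnx⟩
  exact ⟨kp_of_subset_carrier hHf hH'b hAH hAne hB1 h.2.2.2.2.1 ih.1,
    kp_of_outer_pair hHf hH'b hAH hmax.add_eq_neg_compl hB1 h.2.2.2.2.1 hC1 h.2.2.2.2.2 hCiff ih.2.1,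
    kp_symm (kp_of_subset_carrier hHf hH'b hAH hAne hC1 h.2.2.2.2.2 (kp_symm ih.2.2))⟩

end ImpureBeat

section ImpureChord

variable {G : Type*} [AddCommGroup G] [Fintype G] [DecidableEq G]
variable {H : Finset G} {H' : AddSubgroup G} {r : G} {t : ℕ}

omit [Fintype G] in
/-- `x ∈ rseq H r 0 q` iff `x − j r ∈ H` for some `j < q`. [cite: BoothbyDevosMontejano2013, §4] -/
private theorem mem_rseq_zero_iff_sub (hHf : ∀ g, g ∈ H ↔ g ∈ H') {x : G} {q : ℕ} :
    x ∈ rseq H r 0 q ↔ ∃ j, j < q ∧ x - j • r ∈ H' := by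
  rw [mem_rseq]
  constructor
  · rintro ⟨j, hj, hx⟩
    obtain ⟨h, hh, rfl⟩ := mem_vadd_finset.1 hx
    exact ⟨j, hj, by rw [vadd_eq_add, zero_add, add_sub_cancel_left]; exact (hHf h).1 hh⟩
  · rintro ⟨j, hj, hx⟩
    exact ⟨j, hj, mem_vadd_finset.2 ⟨x - j • r, (hHf _).2 hx, by rw [vadd_eq_add, zero_add]; abel⟩⟩

omit [Fintype G] [DecidableEq G] in
/-- For `0 ≤ j < t`: `j r ∈ H` iff `j = 0`. [cite: BoothbyDevosMontejano2013, §4] -/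
private theorem nsmul_mem_iff (hHf : ∀ g, g ∈ H ↔ g ∈ H')
    (hmin : ∀ s : ℕ, 0 < s → s < t → s • r ∉ H) {j : ℕ} (hj : j < t) : j • r ∈ H' ↔ j = 0 := by
  constructor
  · intro h
    by_contra h0
    exact hmin j (Nat.pos_of_ne_zero h0) hj ((hHf _).2 h)
  · rintro rfl; rw [zero_nsmul]; exact H'.zero_mem

omit [Fintype G] in
/-- `R`-sequences are `H`-periodic. [cite: BoothbyDevosMontejano2013, §4] -/
private theorem isPeriodicWith_rseq (hH : IsSubgroupCarrier H) (hHf : ∀ g, g ∈ H ↔ g ∈ H') (a : G)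
    (k : ℕ) : IsPeriodicWith H' (rseq H r a k) :=
  (isPeriodicWith_iff_add_eq hHf).2 (rseq_add hH r a k)

omit [Fintype G] in
/-- `|φ_H(rseq H r a k)| = k` for `k ≤ t`. [cite: BoothbyDevosMontejano2013, §4] -/
private theorem cosetCount_rseq (hH : IsSubgroupCarrier H) (hHf : ∀ g, g ∈ H ↔ g ∈ H')
    (hmin : ∀ s : ℕ, 0 < s → s < t → s • r ∉ H) (a : G) {k : ℕ} (hk : k ≤ t) :
    cosetCount H' (rseq H r a k) = k := by
  have h1 := card_eq_cosetCount_mul hHf (isPeriodicWith_rseq hH hHf a k (r := r))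
  rw [card_rseq hH hmin a hk] at h1
  exact (Nat.eq_of_mul_eq_mul_right hH.nonempty.card_pos h1).symm

/-- `|φ_H(G)| = t`. [cite: BoothbyDevosMontejano2013, §4] -/
private theorem cosetCount_univ_eq (hH : IsSubgroupCarrier H) (hHf : ∀ g, g ∈ H ↔ g ∈ H')
    (hgen : IsCyclicQuotGen H r) (ht : 0 < t) (htH : t • r ∈ H)
    (hmin : ∀ s : ℕ, 0 < s → s < t → s • r ∉ H) : cosetCount H' (univ : Finset G) = t := by
  have h1 := card_eq_cosetCount_mul hHf (X := (univ : Finset G)) (fun h _ => vadd_finset_univ)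
  rw [card_univ, card_univ_eq_of_minimal hH hgen ht htH hmin] at h1
  exact (Nat.eq_of_mul_eq_mul_right hH.nonempty.card_pos h1).symm

omit [Fintype G] in
/-- A member `Y` with `H ∪ Y = rseq H r 0 q`: `Y ∖ H` is `H`-periodic with `q − 1` cosets.
[cite: BoothbyDevosMontejano2013, Def 4.4] -/
private theorem sdiff_rseq_member (hH : IsSubgroupCarrier H) (hHf : ∀ g, g ∈ H ↔ g ∈ H')
    (hmin : ∀ s : ℕ, 0 < s → s < t → s • r ∉ H) {Y : Finset G} {q : ℕ} (hHY : H ∪ Y = rseq H r 0 q)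
    (hqt : q ≤ t) :
    IsPeriodicWith H' (Y \ H) ∧ cosetCount H' (Y \ H) = q - 1 := by
  have hsd : Y \ H = rseq H r 0 q \ H := by rw [← hHY, union_sdiff_left]
  have hper : IsPeriodicWith H' (Y \ H) := by
    rw [hsd]; exact (isPeriodicWith_rseq hH hHf 0 q).sdiff (isPeriodicWith_carrier hHf)
  refine ⟨hper, ?_⟩
  have hsub : H ⊆ rseq H r 0 q := by rw [← hHY]; exact subset_union_left
  have h1 := card_eq_cosetCount_mul hHf hper
  rw [hsd, card_sdiff_of_subset hsub, card_rseq hH hmin 0 hqt] at h1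
  have h2 : q * #H - #H = (q - 1) * #H := by
    rw [Nat.sub_mul, one_mul]
  rw [h2] at h1
  rw [hsd]
  exact (Nat.eq_of_mul_eq_mul_right hH.nonempty.card_pos h1).symm

omit [Fintype G] in
/-- **The pair `(A, B)` of an impure chord**: coarse data `A = (A ∖ H) ⊔ (A ∩ H)`,
`B = (B ∖ H) ⊔ (B ∩ H)`; sums in `H` come only from `(A ∩ H) + (B ∩ H)` since `i + j < t`;
`|φ(A + B)| = m + n − 1`, `|φ(A)| = m`, `|φ(B)| = n`. [cite: Kemperman1960, Thm 5.1 (proof)]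
[cite: BoothbyDevosMontejano2013, Def 4.4] -/
private theorem kp_chord_inner (hH : IsSubgroupCarrier H) (hHf : ∀ g, g ∈ H ↔ g ∈ H') (hH'b : H' ≠ ⊥)
    (hmin : ∀ s : ℕ, 0 < s → s < t → s • r ∉ H) {X Y : Finset G} {p q : ℕ}
    (hHX : H ∪ X = rseq H r 0 p) (hHY : H ∪ Y = rseq H r 0 q) (hp : 1 ≤ p) (hq : 1 ≤ q)
    (hpq : p + q - 2 < t) (hsd : (X + Y) \ H = rseq H r r (p + q - 2))
    (hX0 : (X ∩ H).Nonempty) (hY0 : (Y ∩ H).Nonempty) (hk : KP (X ∩ H) (Y ∩ H)) : KP X Y := by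
  have memH : ∀ {x}, x ∈ H → x ∈ H' := fun hx => (hHf _).1 hx
  obtain ⟨hX1, cX⟩ := sdiff_rseq_member hH hHf hmin hHX (by omega)
  obtain ⟨hY1, cY⟩ := sdiff_rseq_member hH hHf hmin hHY (by omega)
  have hdX : IsQuasiPeriodicDecomp H' X (X \ H) (X ∩ H) :=
    ⟨hH'b, disjoint_sdiff_inter X H, sdiff_union_inter X H, hX1,
      fun x hx y hy => H'.sub_mem (memH (mem_inter.1 hx).2) (memH (mem_inter.1 hy).2)⟩
  have hdY : IsQuasiPeriodicDecomp H' Y (Y \ H) (Y ∩ H) :=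
    ⟨hH'b, disjoint_sdiff_inter Y H, sdiff_union_inter Y H, hY1,
      fun x hx y hy => H'.sub_mem (memH (mem_inter.1 hx).2) (memH (mem_inter.1 hy).2)⟩
  intro hyp
  refine exists_isKempermanDecompI_of_coarse_of_imp hHf hdX hdY hX0 hY0 ?_ ?_ hk hyp
  · intro x hx y hy x' hx' y' hy' hxy
    have hx'H := memH (mem_inter.1 hx').2
    have hy'H := memH (mem_inter.1 hy').2
    have hs : x + y ∈ H' := by
      have := H'.add_mem hxy (H'.add_mem hx'H hy'H); rwa [sub_add_cancel] at this
    obtain ⟨i, hi, hxi⟩ := (mem_rseq_zero_iff_sub hHf).1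
      (show x ∈ rseq H r 0 p by rw [← hHX]; exact mem_union_right _ hx)
    obtain ⟨j, hj, hyj⟩ := (mem_rseq_zero_iff_sub hHf).1
      (show y ∈ rseq H r 0 q by rw [← hHY]; exact mem_union_right _ hy)
    have hij : (i + j) • r ∈ H' := by
      have e : (i + j) • r = (x + y) - ((x - i • r) + (y - j • r)) := by rw [add_nsmul]; abel
      rw [e]; exact H'.sub_mem hs (H'.add_mem hxi hyj)
    have h0 := (nsmul_mem_iff hHf hmin (by omega)).1 hij
    have hi0 : i = 0 := by omega
    have hj0 : j = 0 := by omega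
    rw [hi0, zero_nsmul, sub_zero] at hxi
    rw [hj0, zero_nsmul, sub_zero] at hyj
    exact ⟨H'.sub_mem hxi hx'H, H'.sub_mem hyj hy'H⟩
  · have hin : ∀ z ∈ (X ∩ H) + (Y ∩ H), z ∈ H := by
      intro z hz
      obtain ⟨x, hx, y, hy, rfl⟩ := mem_add.1 hz
      exact (hHf _).2 (H'.add_mem (memH (mem_inter.1 hx).2) (memH (mem_inter.1 hy).2))
    have hsub : (X ∩ H) + (Y ∩ H) ⊆ (X + Y) ∩ H := by
      intro z hz
      exact mem_inter.2 ⟨add_subset_add inter_subset_left inter_subset_left hz, hin z hz⟩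
    have c1 : cosetCount H' (X + Y) = (p + q - 2) + 1 := by
      rw [← sdiff_union_inter (X + Y) H, cosetCount_union, hsd, cosetCount_rseq hH hHf hmin r hpq.le,
        cosetCount_eq_one_of_sub_mem ((hX0.add hY0).mono hsub) fun x hx y hy =>
          H'.sub_mem (memH (mem_inter.1 hx).2) (memH (mem_inter.1 hy).2)]
      intro u hu v hv huv
      exact (mem_sdiff.1 hu).2 ((hHf u).2 (by
        have := H'.add_mem huv (memH (mem_inter.1 hv).2); rwa [sub_add_cancel] at this))
    rw [c1, hdX.cosetCount_eq hX0, hdY.cosetCount_eq hY0, cX, cY]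
    omega

/-- **The pairs `(B, C)` and `(A, C)` of an impure chord**: `Y ∈ {A, B}` occupies the cosets
`0, r, …, (q−1)r`, `C ∖ H = −\overline{rseq H r r k ∪ H}` (`k = m + n − 2`), `Y + C = −Z̄` for the
third member `Z`; sums in `H` come only from `(Y ∩ H) + (C ∩ H)`, and
`|φ(Y + C)| = t − p' + 1`, `|φ(Y)| = q`, `|φ(C)| = t − k`. [cite: Kemperman1960, Thm 5.1 (proof)]
[cite: BoothbyDevosMontejano2013, Def 4.4] -/
private theorem kp_chord_outer (hH : IsSubgroupCarrier H) (hHf : ∀ g, g ∈ H ↔ g ∈ H') (hH'b : H' ≠ ⊥)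
    (hgen : IsCyclicQuotGen H r) (ht : 0 < t) (htH : t • r ∈ H)
    (hmin : ∀ s : ℕ, 0 < s → s < t → s • r ∉ H) {Y Z C : Finset G} {q p' k : ℕ}
    (hHY : H ∪ Y = rseq H r 0 q) (hHZ : H ∪ Z = rseq H r 0 p') (hq : 1 ≤ q)
    (hqk : q ≤ k + 1) (hkt : k < t) (hsum : p' + q = k + 2)
    (hCH : C \ H = -((rseq H r r k ∪ H)ᶜ)) (hYC : Y + C = -Zᶜ)
    (hY0 : (Y ∩ H).Nonempty) (hC0 : (C ∩ H).Nonempty) (hk : KP (Y ∩ H) (C ∩ H)) : KP Y C := by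
  have memH : ∀ {x}, x ∈ H → x ∈ H' := fun hx => (hHf _).1 hx
  have hHper : IsPeriodicWith H' H := isPeriodicWith_carrier hHf
  obtain ⟨hY1, cY⟩ := sdiff_rseq_member hH hHf hmin hHY (by omega)
  have hSper : IsPeriodicWith H' (rseq H r r k ∪ H) := (isPeriodicWith_rseq hH hHf r k).union hHper
  have hC1 : IsPeriodicWith H' (C \ H) := by rw [hCH]; exact hSper.compl.neg
  have hdY : IsQuasiPeriodicDecomp H' Y (Y \ H) (Y ∩ H) :=
    ⟨hH'b, disjoint_sdiff_inter Y H, sdiff_union_inter Y H, hY1,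
      fun x hx y hy => H'.sub_mem (memH (mem_inter.1 hx).2) (memH (mem_inter.1 hy).2)⟩
  have hdC : IsQuasiPeriodicDecomp H' C (C \ H) (C ∩ H) :=
    ⟨hH'b, disjoint_sdiff_inter C H, sdiff_union_inter C H, hC1,
      fun x hx y hy => H'.sub_mem (memH (mem_inter.1 hx).2) (memH (mem_inter.1 hy).2)⟩
  intro hyp
  refine exists_isKempermanDecompI_of_coarse_of_imp hHf hdY hdC hY0 hC0 ?_ ?_ hk hyp
  · intro y hy c hc y' hy' c' hc' hq'
    have hy'H := memH (mem_inter.1 hy').2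
    have hc'H := memH (mem_inter.1 hc').2
    have hs : y + c ∈ H' := by
      have := H'.add_mem hq' (H'.add_mem hy'H hc'H); rwa [sub_add_cancel] at this
    obtain ⟨j, hj, hyj⟩ := (mem_rseq_zero_iff_sub hHf).1
      (show y ∈ rseq H r 0 q by rw [← hHY]; exact mem_union_right _ hy)
    have hj0 : j = 0 := by
      by_contra hj0
      -- then `c ∉ H` and `−c ∈ rseq H r r k`, contradicting `c ∈ C ∖ H = −(…)ᶜ`
      have hyH : y ∉ H := fun hyH => hj0 ((nsmul_mem_iff hHf hmin (by omega)).1 (by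
        have := H'.sub_mem (memH hyH) hyj; rwa [sub_sub_cancel] at this))
      have hcH : c ∉ H := fun hcH => hyH ((hHf y).2 (by
        have := H'.sub_mem hs (memH hcH); rwa [add_sub_cancel_right] at this))
      have hcC : c ∈ C \ H := mem_sdiff.2 ⟨hc, hcH⟩
      rw [hCH, mem_neg', mem_compl] at hcC
      refine hcC (mem_union_left _ (mem_rseq.2 ⟨j - 1, by omega, mem_vadd_finset.2
        ⟨-c - (r + (j - 1) • r), (hHf _).2 ?_, by rw [vadd_eq_add]; abel⟩⟩))
      have e : -c - (r + (j - 1) • r) = (y - j • r) - (y + c) := by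
        have : r + (j - 1) • r = j • r := by
          conv_rhs => rw [show j = (j - 1) + 1 by omega, add_nsmul, one_nsmul, add_comm]
        rw [this]; abel
      rw [e]; exact H'.sub_mem hyj hs
    rw [hj0, zero_nsmul, sub_zero] at hyj
    have hcH' : c ∈ H' := by
      have := H'.sub_mem hs hyj; rwa [add_sub_cancel_left] at this
    exact ⟨H'.sub_mem hyj hy'H, H'.sub_mem hcH' hc'H⟩
  · -- the count
    have cU := cosetCount_univ_eq hH hHf hgen ht htH hmin
    -- `Zᶜ = (H ∪ Z)ᶜ ∪ (H \ Z)`, `H \ Z ≠ ∅`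
    have hZc : (H \ Z).Nonempty := by
      obtain ⟨x, hx⟩ := hY0.add hC0
      obtain ⟨y, hy, c, hc, rfl⟩ := mem_add.1 hx
      have hin : y + c ∈ H := (hHf _).2 (H'.add_mem (memH (mem_inter.1 hy).2) (memH (mem_inter.1 hc).2))
      have hs : y + c ∈ Y + C := add_mem_add (mem_inter.1 hy).1 (mem_inter.1 hc).1
      rw [hYC, mem_neg', mem_compl] at hs
      exact ⟨-(y + c), mem_sdiff.2 ⟨hH.neg_mem hin, hs⟩⟩
    have c1 : cosetCount H' (Y + C) = cosetCount H' (H ∪ Z)ᶜ + 1 := by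
      rw [hYC, cosetCount_neg]
      have e : Zᶜ = (H ∪ Z)ᶜ ∪ (H \ Z) := by
        ext x; simp only [mem_compl, mem_union, mem_sdiff, not_or]
        constructor
        · intro h; by_cases hx : x ∈ H; exacts [Or.inr ⟨hx, h⟩, Or.inl ⟨hx, h⟩]
        · rintro (h | h); exacts [h.2, h.2]
      rw [e, cosetCount_union, cosetCount_eq_one_of_sub_mem hZc fun x hx y hy =>
        H'.sub_mem (memH (mem_sdiff.1 hx).1) (memH (mem_sdiff.1 hy).1)]
      intro x hx y hy hxy
      rw [mem_compl, mem_union, not_or] at hx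
      exact hx.1 ((hHf x).2 (by
        have := H'.add_mem hxy (memH (mem_sdiff.1 hy).1); rwa [sub_add_cancel] at this))
    have c2 : cosetCount H' (H ∪ Z) + cosetCount H' (H ∪ Z)ᶜ = t := by
      rw [← cU]; exact cosetCount_add_compl (by rw [hHZ]; exact isPeriodicWith_rseq hH hHf 0 p')
    rw [hHZ, cosetCount_rseq hH hHf hmin 0 (by omega : p' ≤ t)] at c2
    rw [hHZ] at c1
    have c3 : cosetCount H' (rseq H r r k ∪ H) + cosetCount H' (rseq H r r k ∪ H)ᶜ = t := by
      rw [← cU]; exact cosetCount_add_compl hSper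
    have c4 : cosetCount H' (rseq H r r k ∪ H) = k + 1 := by
      rw [cosetCount_union, cosetCount_rseq hH hHf hmin r hkt.le, cosetCount_eq_one_of_sub_mem
        hH.nonempty fun x hx y hy => H'.sub_mem (memH hx) (memH hy)]
      intro x hx y hy hxy
      obtain ⟨i, hi, hxi⟩ := mem_rseq.1 hx
      obtain ⟨h, hh, rfl⟩ := mem_vadd_finset.1 hxi
      have : (i + 1) • r ∈ H' := by
        have e : (i + 1) • r = ((r + i • r) +ᵥ h) - y - h + y := by
          rw [vadd_eq_add, add_nsmul, one_nsmul]; abel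
        rw [e]; exact H'.add_mem (H'.sub_mem hxy (memH hh)) (memH hy)
      have := (nsmul_mem_iff hHf hmin (by omega)).1 this
      omega
    rw [c4] at c3
    have c5 : cosetCount H' (C \ H) = cosetCount H' (rseq H r r k ∪ H)ᶜ := by
      rw [hCH, cosetCount_neg]
    rw [c1, hdY.cosetCount_eq hY0, hdC.cosetCount_eq hC0, cY, c5]
    omega

/-- `C ∖ H` for an impure chord: `−\overline{rseq H r r (m+n−2) ∪ H}`.
[cite: BoothbyDevosMontejano2013, Def 4.4] -/
private theorem chord_sdiff_eq (hH : IsSubgroupCarrier H) {A B C : Finset G} {k : ℕ}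
    (hCH : C \ H = third A B \ H) (hsd : (A + B) \ H = rseq H r r k) :
    C \ H = -((rseq H r r k ∪ H)ᶜ) := by
  rw [hCH, third, compl_neg_sdiff_carrier hH, hsd]

/-- The pair property for an impure chord in normal position relative to `H` (`|H| ≥ 2`), from the
pair property of its continuation `(A ∩ H, B ∩ H, C ∩ H)`. [cite: Kemperman1960, Thm 5.1 (proof)]
[cite: BoothbyDevosMontejano2013, Def 4.4; Thm 4.5] -/
private theorem trioKP_of_isImpureChordAt {A B C : Finset G} (hH : IsSubgroupCarrier H)
    (h2H : 2 ≤ #H) (h : IsImpureChordAt H r A B C) (hmax : IsMaximalTrio A B C)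
    (ih : TrioKP (A ∩ H) (B ∩ H) (C ∩ H)) : TrioKP A B C := by
  set H' : AddSubgroup G := hH.toAddSubgroup
  have hHf : ∀ g, g ∈ H ↔ g ∈ H' := fun g => hH.mem_toAddSubgroup.symm
  have hH'b : H' ≠ ⊥ := by
    intro hbot
    have hsub : H ⊆ {0} := fun x hx => by
      have := (hHf x).1 hx
      rw [hbot, AddSubgroup.mem_bot] at this
      exact mem_singleton.2 this
    have := card_le_card hsub
    rw [card_singleton] at this
    omega
  have hgen := h.1
  obtain ⟨m, hm, hHA⟩ := h.2.1
  obtain ⟨n, hn, hHB⟩ := h.2.2.1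
  have hCH := h.2.2.2.1
  have hA0 := h.2.2.2.2.2.1
  have hB0 := h.2.2.2.2.2.2.1
  have hC0 := h.2.2.2.2.2.2.2
  obtain ⟨t, ht, htH, hmin⟩ := exists_minimal_nsmul_mem hH r
  have hlt := h.add_sub_two_lt hH hHA hHB hm ht htH hmin
  have hsd := h.add_sdiff_eq hH hHA hHB hm hn hmin hlt
  have hCsd := chord_sdiff_eq hH hCH hsd
  refine ⟨kp_chord_inner hH hHf hH'b hmin hHA hHB (by omega) (by omega) hlt hsd hA0 hB0 ih.1,
    kp_chord_outer hH hHf hH'b hgen ht htH hmin hHB hHA (by omega) (by omega) hlt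
      (by omega) hCsd hmax.add_eq_neg_compl hB0 hC0 ih.2.1,
    kp_symm (kp_chord_outer hH hHf hH'b hgen ht htH hmin hHA hHB (by omega) (by omega)
      hlt (by omega) hCsd (by rw [add_comm]; exact hmax.rotate.add_eq_neg_compl) hA0 hC0
      (kp_symm ih.2.2))⟩

end ImpureChord

section Transport

variable {G : Type*} [AddCommGroup G] [DecidableEq G] {H' : AddSubgroup G}

/-! ### Transport of Kemperman decompositions from the subgroup type `↥H'` -/

omit [DecidableEq G] in
/-- Membership in the pushed-forward subgroup. [cite: BoothbyDevosMontejano2013, Thm 4.5] -/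
theorem mem_map_subtype_iff {L : AddSubgroup ↥H'} {z : ↥H'} :
    (z : G) ∈ L.map H'.subtype ↔ z ∈ L := by
  constructor
  · intro h
    obtain ⟨w, hw, hwz⟩ := AddSubgroup.mem_map.1 h
    have : w = z := Subtype.ext hwz
    rwa [← this]
  · intro h; exact AddSubgroup.mem_map.2 ⟨z, h, rfl⟩

omit [DecidableEq G] in
/-- Elements of the pushed-forward subgroup lie in `H'`. [cite: BoothbyDevosMontejano2013, Thm 4.5] -/
theorem mem_of_mem_map_subtype {L : AddSubgroup ↥H'} {g : G} (h : g ∈ L.map H'.subtype) : g ∈ H' := by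
  obtain ⟨w, -, rfl⟩ := AddSubgroup.mem_map.1 h
  exact w.2

/-- Representation counts are the same in `↥H'` and in `G`. [cite: BoothbyDevosMontejano2013, Thm 4.5] -/
theorem addConvolution_toSub {X Y : Finset G} (hX : (X : Set G) ⊆ H') (z : ↥H') :
    (toSub H' X).addConvolution (toSub H' Y) z = X.addConvolution Y z := by
  rw [addConvolution_eq_card_filter, addConvolution_eq_card_filter]
  have : (toSub H' Y).filter (fun b => z - b ∈ toSub H' X) =
      toSub H' (Y.filter fun b => (z : G) - b ∈ X) := by
    ext b
    simp only [mem_filter, mem_toSub, AddSubgroupClass.coe_sub]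
  rw [this, card_toSub]
  intro b hb
  rw [mem_coe, mem_filter] at hb
  -- `b = z − (z − b)` with `z − b ∈ X ⊆ H'`
  have := H'.sub_mem z.2 (hX (mem_coe.2 hb.2))
  rwa [sub_sub_cancel] at this

/-- Outside `H'` nothing is represented. [cite: BoothbyDevosMontejano2013, Thm 4.5] -/
theorem addConvolution_eq_zero_of_notMem {X Y : Finset G} (hX : (X : Set G) ⊆ H')
    (hY : (Y : Set G) ⊆ H') {z : G} (hz : z ∉ H') : X.addConvolution Y z = 0 := by
  rw [addConvolution_eq_card_filter, card_eq_zero, filter_eq_empty_iff]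
  intro b hb hzb
  exact hz (by
    have := H'.add_mem (hX (mem_coe.2 hzb)) (hY (mem_coe.2 hb))
    rwa [sub_add_cancel] at this)

/-- Periodicity descends from `↥H'` to `G`. [cite: BoothbyDevosMontejano2013, Thm 4.5] -/
theorem isPeriodic_of_toSub {Z : Finset G} (hZ : (Z : Set G) ⊆ H') (h : IsPeriodic (toSub H' Z)) :
    IsPeriodic Z := by
  classical
  obtain ⟨Q, hQ, hper⟩ := h
  refine ⟨Q.map H'.subtype, ?_, ?_⟩
  · intro hbot
    rcases Q.bot_or_exists_ne_zero with hF | ⟨f, hfF, hf0⟩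
    · exact hQ hF
    · have hmem : ((f : ↥H') : G) ∈ Q.map H'.subtype := mem_map_subtype_iff.2 hfF
      rw [hbot, AddSubgroup.mem_bot] at hmem
      exact hf0 (Subtype.ext hmem)
  · intro g hg
    obtain ⟨f, hf, rfl⟩ := AddSubgroup.mem_map.1 hg
    have := hper f hf
    rw [AddSubgroup.coe_subtype, ← image_val_toSub hZ, ← image_val_vadd, this]

/-- Periodicity lifts from `G` to `↥H'` (for a nonempty set). [cite: BoothbyDevosMontejano2013, Thm 4.5] -/
theorem isPeriodic_toSub {Z : Finset G} (hZ : (Z : Set G) ⊆ H') (hne : Z.Nonempty) (h : IsPeriodic Z) :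
    IsPeriodic (toSub H' Z) := by
  classical
  obtain ⟨Q, hQ, hper⟩ := h
  have hQH : Q ≤ H' := by
    intro q hq
    obtain ⟨z, hz⟩ := hne
    have := H'.sub_mem (hZ (mem_coe.2 (hper.add_mem hq hz))) (hZ (mem_coe.2 hz))
    rwa [add_sub_cancel_right] at this
  refine ⟨Q.comap H'.subtype, ?_, ?_⟩
  · intro hbot
    rcases Q.bot_or_exists_ne_zero with hF | ⟨q, hq, hq0⟩
    · exact hQ hF
    · have : (⟨q, hQH hq⟩ : ↥H') ∈ Q.comap H'.subtype := by
        rw [AddSubgroup.mem_comap]; exact hq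
      rw [hbot, AddSubgroup.mem_bot] at this
      exact hq0 (by simpa using congrArg Subtype.val this)
  · intro q hq
    rw [AddSubgroup.mem_comap, AddSubgroup.coe_subtype] at hq
    ext x
    rw [mem_vadd_finset, mem_toSub]
    constructor
    · rintro ⟨y, hy, rfl⟩
      rw [mem_toSub] at hy
      have := hper.add_mem hq hy
      simpa using this
    · intro hx
      refine ⟨-q + x, mem_toSub.2 ?_, by simp⟩
      have := hper.add_mem (Q.neg_mem hq) hx
      simpa using this

/-- Quasi-periodic decompositions descend from `↥H'` to `G`. [cite: BoothbyDevosMontejano2013, Thm 4.5] -/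
theorem IsQuasiPeriodicDecomp.of_toSub {L : AddSubgroup ↥H'} {W : Finset G} {Z₁ Z₀ : Finset ↥H'}
    (hW : (W : Set G) ⊆ H') (hd : IsQuasiPeriodicDecomp L (toSub H' W) Z₁ Z₀) :
    IsQuasiPeriodicDecomp (L.map H'.subtype) W (Z₁.image Subtype.val) (Z₀.image Subtype.val) := by
  classical
  refine ⟨?_, ?_, ?_, ?_, ?_⟩
  · intro hbot
    rcases L.bot_or_exists_ne_zero with hF | ⟨f, hfF, hf0⟩
    · exact hd.ne_bot hF
    · have hmem : ((f : ↥H') : G) ∈ L.map H'.subtype := mem_map_subtype_iff.2 hfF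
      rw [hbot, AddSubgroup.mem_bot] at hmem
      exact hf0 (Subtype.ext hmem)
  · exact (disjoint_image Subtype.val_injective).2 hd.disjoint
  · rw [← image_union, hd.union_eq, image_val_toSub hW]
  · intro g hg
    obtain ⟨f, hf, rfl⟩ := AddSubgroup.mem_map.1 hg
    have := hd.periodic f hf
    rw [AddSubgroup.coe_subtype, ← image_val_vadd, this]
  · intro x hx y hy
    obtain ⟨x', hx', rfl⟩ := mem_image.1 hx
    obtain ⟨y', hy', rfl⟩ := mem_image.1 hy
    have := hd.sub_mem x' hx' y' hy'
    rw [← AddSubgroupClass.coe_sub]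
    exact mem_map_subtype_iff.2 this

/-- Coset counts are the same in `↥H'` and in `G`. [cite: BoothbyDevosMontejano2013, Thm 4.5] -/
theorem cosetCount_map_subtype {L : AddSubgroup ↥H'} {W : Finset G} (hW : (W : Set G) ⊆ H') :
    cosetCount (L.map H'.subtype) W = cosetCount L (toSub H' W) := by
  classical
  have hle : L ≤ (L.map H'.subtype).comap H'.subtype := AddSubgroup.le_comap_map _ _
  set φ := QuotientAddGroup.map L (L.map H'.subtype) H'.subtype hle
  have hφ : Function.Injective φ := by
    intro p q hpq
    induction p using QuotientAddGroup.induction_on with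
    | H x => ?_
    induction q using QuotientAddGroup.induction_on with
    | H y => ?_
    rw [QuotientAddGroup.map_mk, QuotientAddGroup.map_mk, QuotientAddGroup.eq] at hpq
    rw [QuotientAddGroup.eq]
    have e : -H'.subtype x + H'.subtype y = ((-x + y : ↥H') : G) := by simp
    rw [e] at hpq
    exact mem_map_subtype_iff.1 hpq
  rw [cosetCount_eq_card_image, cosetCount_eq_card_image]
  have himg : W.image (QuotientAddGroup.mk : G → G ⧸ L.map H'.subtype) =
      ((toSub H' W).image (QuotientAddGroup.mk : ↥H' → ↥H' ⧸ L)).image φ := by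
    conv_lhs => rw [← image_val_toSub hW]
    rw [image_image, image_image]
    refine image_congr fun x _ => ?_
    simp only [Function.comp_apply]
    rw [QuotientAddGroup.map_mk, AddSubgroup.coe_subtype]
  rw [himg, card_image_of_injective _ hφ]

/-- Elementary pairs descend from `↥H'` to `G`. [cite: Kemperman1960, §5] [cite: BoothbyDevosMontejano2013, Thm 4.5] -/
theorem IsElementaryPair.of_toSub {X Y : Finset G} (hX : (X : Set G) ⊆ H') (hY : (Y : Set G) ⊆ H')
    (h : IsElementaryPair (toSub H' X) (toSub H' Y)) : IsElementaryPair X Y := by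
  classical
  have memX : ∀ {x}, x ∈ X → x ∈ H' := fun hx => hX (mem_coe.2 hx)
  have memY : ∀ {y}, y ∈ Y → y ∈ H' := fun hy => hY (mem_coe.2 hy)
  -- representation counts
  have hr : ∀ z : G, X.addConvolution Y z = 1 ↔ ∃ hz : z ∈ H', (toSub H' X).addConvolution (toSub H' Y) ⟨z, hz⟩ = 1 := by
    intro z
    by_cases hz : z ∈ H'
    · rw [← addConvolution_toSub hX ⟨z, hz⟩]
      exact ⟨fun h => ⟨hz, h⟩, fun ⟨_, h⟩ => h⟩
    · rw [addConvolution_eq_zero_of_notMem hX hY hz]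
      exact ⟨fun h => absurd h zero_ne_one, fun ⟨h, _⟩ => absurd h hz⟩
  rcases h with h | h | h | h
  · exact Or.inl (h.of_card_eq (card_toSub hX).symm (card_toSub hY).symm)
  · obtain ⟨h2X, h2Y, d, hXd, hYd, hord⟩ := h
    rw [card_toSub hX] at h2X; rw [card_toSub hY] at h2Y
    refine Or.inr (Or.inl ⟨h2X, h2Y, (d : G), isAP_of_toSub hX hXd, isAP_of_toSub hY hYd, ?_⟩)
    rw [AddSubgroup.addOrderOf_coe, card_toSub hX, card_toSub hY] at *
    exact hord
  · obtain ⟨K, a, b, ha, hb, hXa, hYb, hcard, huniq⟩ := h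
    refine Or.inr (Or.inr (Or.inl ⟨K.map H'.subtype, a, b, mem_toSub.1 ha, mem_toSub.1 hb, ?_, ?_, ?_, ?_⟩))
    · intro x hx
      have := hXa ⟨x, memX hx⟩ (mem_toSub.2 hx)
      have e : x - (a : G) = ((⟨x, memX hx⟩ - a : ↥H') : G) := rfl
      rw [e]; exact mem_map_subtype_iff.2 this
    · intro y hy
      have := hYb ⟨y, memY hy⟩ (mem_toSub.2 hy)
      have e : y - (b : G) = ((⟨y, memY hy⟩ - b : ↥H') : G) := rfl
      rw [e]; exact mem_map_subtype_iff.2 this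
    · rw [AddSubgroup.card_subtype, ← card_toSub hX, ← card_toSub hY]; exact hcard
    · intro z
      rw [hr z]
      constructor
      · rintro ⟨hz, h1⟩
        have := (huniq _).1 h1
        exact congrArg Subtype.val this
      · intro hz
        have hz' : z ∈ H' := by rw [hz]; exact H'.add_mem a.2 b.2
        refine ⟨hz', (huniq _).2 (Subtype.ext ?_)⟩
        exact hz
  · obtain ⟨K, a, b, g, ha, hb, hXa, hYb, hne1, hXap, hYap, hiff⟩ := h
    have hXne : X.Nonempty := ⟨a, mem_toSub.1 ha⟩
    have hYne : Y.Nonempty := ⟨b, mem_toSub.1 hb⟩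
    refine Or.inr (Or.inr (Or.inr ⟨K.map H'.subtype, a, b, g, mem_toSub.1 ha, mem_toSub.1 hb,
      ?_, ?_, ?_, fun hp => hXap (isPeriodic_toSub hX hXne hp), fun hp => hYap (isPeriodic_toSub hY hYne hp), ?_⟩))
    · intro x hx
      have := hXa ⟨x, memX hx⟩ (mem_toSub.2 hx)
      have e : x - (a : G) = ((⟨x, memX hx⟩ - a : ↥H') : G) := rfl
      rw [e]; exact mem_map_subtype_iff.2 this
    · intro y hy
      have := hYb ⟨y, memY hy⟩ (mem_toSub.2 hy)
      have e : y - (b : G) = ((⟨y, memY hy⟩ - b : ↥H') : G) := rfl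
      rw [e]; exact mem_map_subtype_iff.2 this
    · intro z hz
      obtain ⟨hz', h1⟩ := (hr z).1 hz
      exact hne1 _ h1
    · intro x
      by_cases hxH : x ∈ H'
      · have := hiff ⟨x, hxH⟩
        rw [mem_toSub, mem_toSub] at this
        rw [this]
        have e : (g : G) - x - b = ((g - ⟨x, hxH⟩ - b : ↥H') : G) := rfl
        rw [e, mem_map_subtype_iff]
        exact Iff.rfl
      · constructor
        · intro hx; exact absurd (memX hx) hxH
        · rintro ⟨h1, -⟩
          exfalso; apply hxH
          have hm := mem_of_mem_map_subtype h1
          -- `x = g − b − (g − x − b)`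
          have : x = (g : G) - b - ((g : G) - x - b) := by abel
          rw [this]
          exact H'.sub_mem (H'.sub_mem g.2 b.2) hm

/-- Kemperman decompositions descend from `↥H'` to `G`. [cite: Kemperman1960, Thm 5.1]
[cite: BoothbyDevosMontejano2013, Thm 4.5] -/
theorem IsKempermanDecompI.of_toSub {L : AddSubgroup ↥H'} {X Y : Finset G} {X₁ X₀ Y₁ Y₀ : Finset ↥H'}
    (hX : (X : Set G) ⊆ H') (hY : (Y : Set G) ⊆ H')
    (h : IsKempermanDecompI L (toSub H' X) (toSub H' Y) X₁ X₀ Y₁ Y₀) :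
    IsKempermanDecompI (L.map H'.subtype) X Y (X₁.image Subtype.val) (X₀.image Subtype.val)
      (Y₁.image Subtype.val) (Y₀.image Subtype.val) := by
  classical
  have memX : ∀ {x}, x ∈ X → x ∈ H' := fun hx => hX (mem_coe.2 hx)
  have memY : ∀ {y}, y ∈ Y → y ∈ H' := fun hy => hY (mem_coe.2 hy)
  have hX₀ : ((X₀.image Subtype.val : Finset G) : Set G) ⊆ H' := by
    intro x hx; obtain ⟨x', -, rfl⟩ := mem_image.1 (mem_coe.1 hx); exact x'.2
  have hY₀ : ((Y₀.image Subtype.val : Finset G) : Set G) ⊆ H' := by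
    intro x hx; obtain ⟨x', -, rfl⟩ := mem_image.1 (mem_coe.1 hx); exact x'.2
  refine
    { decomp_left := h.decomp_left.of_toSub hX
      decomp_right := h.decomp_right.of_toSub hY
      left_nonempty := h.left_nonempty.image _
      right_nonempty := h.right_nonempty.image _
      quot_unique := ?_
      cosetCount_add := ?_
      elementary := ?_ }
  · intro a ha b hb a₀ ha₀ b₀ hb₀ hq
    obtain ⟨a₀', ha₀', rfl⟩ := mem_image.1 ha₀
    obtain ⟨b₀', hb₀', rfl⟩ := mem_image.1 hb₀
    have e : a + b - ((a₀' : G) + b₀') = ((⟨a, memX ha⟩ + ⟨b, memY hb⟩ - (a₀' + b₀') : ↥H') : G) := rfl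
    rw [e, mem_map_subtype_iff] at hq
    obtain ⟨h1, h2⟩ := h.quot_unique ⟨a, memX ha⟩ (mem_toSub.2 ha) ⟨b, memY hb⟩ (mem_toSub.2 hb)
      a₀' ha₀' b₀' hb₀' hq
    have e1 : a - (a₀' : G) = ((⟨a, memX ha⟩ - a₀' : ↥H') : G) := rfl
    have e2 : b - (b₀' : G) = ((⟨b, memY hb⟩ - b₀' : ↥H') : G) := rfl
    rw [e1, e2, mem_map_subtype_iff, mem_map_subtype_iff]
    exact ⟨h1, h2⟩
  · rw [cosetCount_map_subtype (coe_add_subset hX hY), cosetCount_map_subtype hX,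
      cosetCount_map_subtype hY, toSub_add hX hY]
    exact h.cosetCount_add
  · have := h.elementary
    rw [← toSub_image_val X₀, ← toSub_image_val Y₀] at this
    exact IsElementaryPair.of_toSub hX₀ hY₀ this

/-- `KP` descends from `↥H'` to `G`. [cite: Kemperman1960, Thm 5.1] -/
private theorem kp_of_toSub {X Y : Finset G} (hX : (X : Set G) ⊆ H') (hY : (Y : Set G) ⊆ H')
    (h : KP (toSub H' X) (toSub H' Y)) : KP X Y := by
  classical
  intro hyp
  have hyp' : ¬ IsPeriodic (toSub H' X + toSub H' Y) ∨
      ∃ c, (toSub H' X).addConvolution (toSub H' Y) c = 1 := by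
    rcases hyp with h1 | ⟨c, hc⟩
    · left
      rw [← toSub_add hX hY]
      exact fun hp => h1 (isPeriodic_of_toSub (coe_add_subset hX hY) hp)
    · right
      by_cases hcH : c ∈ H'
      · exact ⟨⟨c, hcH⟩, by rw [addConvolution_toSub hX]; exact hc⟩
      · rw [addConvolution_eq_zero_of_notMem hX hY hcH] at hc
        exact absurd hc zero_ne_one
  obtain ⟨L, X₁, X₀, Y₁, Y₀, hd⟩ := h hyp'
  exact ⟨_, _, _, _, _, hd.of_toSub hX hY⟩

/-- The pair property descends from `↥H'` to `G`. [cite: Kemperman1960, Thm 5.1] -/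
private theorem trioKP_of_toSub {X Y Z : Finset G} (hX : (X : Set G) ⊆ H') (hY : (Y : Set G) ⊆ H')
    (hZ : (Z : Set G) ⊆ H') (h : TrioKP (toSub H' X) (toSub H' Y) (toSub H' Z)) : TrioKP X Y Z :=
  ⟨kp_of_toSub hX hY h.1, kp_of_toSub hY hZ h.2.1, kp_of_toSub hZ hX h.2.2⟩

end Transport

section Main

/-! ### The walk -/

/-- Every maximal trio of deficiency `1` with nonempty members has the pair property `TrioKP`: by
induction on `|G|` through `kemperman_structure_step`. [cite: Kemperman1960, Thm 5.1]
[cite: BoothbyDevosMontejano2013, Thm 4.5] -/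
private theorem trioKP_of_isMaximalTrio :
    ∀ (n : ℕ) (G : Type u) [AddCommGroup G] [Fintype G] [DecidableEq G], Fintype.card G = n →
      ∀ (A B C : Finset G), IsMaximalTrio A B C → trioDeficiency A B C = 1 →
        A.Nonempty → B.Nonempty → C.Nonempty → TrioKP A B C := by
  intro n
  induction n using Nat.strong_induction_on with
  | _ n ihn => ?_
  intro G _ _ _ hcard A B C hmax hδ hA hB hC
  have hδpos : 0 < trioDeficiency A B C := by rw [hδ]; exact Int.one_pos
  obtain ⟨H, hH, hHu, hstr⟩ := kemperman_structure_step hmax hδpos hA hB hC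
  classical
  rcases hstr with h | h | h | h
  · obtain ⟨-, -, hδH⟩ := h.isMaximalTrio hH
    have h1 : #H = 1 := by rw [hδ] at hδH; exact_mod_cast hδH.symm
    have hH0 := carrier_eq_singleton_zero hH h1
    subst hH0
    obtain ⟨A', B', C', hAt, hsim⟩ := h
    have hne := hsim.nonempty_iff.2 ⟨hA, hB, hC⟩
    exact hsim.trioKP (trioKP_of_isPureBeatAt hAt (by rw [hsim.trioDeficiency_eq]; exact hδ) hne.2.1)
  · obtain ⟨-, -, hδH⟩ := h.isMaximalTrio hH
    have h1 : #H = 1 := by rw [hδ] at hδH; exact_mod_cast hδH.symm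
    have hH0 := carrier_eq_singleton_zero hH h1
    subst hH0
    obtain ⟨r, A', B', C', hAt, hsim⟩ := h
    have hne := hsim.nonempty_iff.2 ⟨hA, hB, hC⟩
    exact hsim.trioKP (trioKP_of_isPureChordAt hAt (by rw [hsim.trioDeficiency_eq]; exact hδ) hne.2.2)
  · obtain ⟨A₀, B₀, C₀, hs, hAt, hmaxIn, hA₀, hB₀, hC₀, hδIn⟩ := h.exists_continuation hH hmax hA hB hC
    have hmax₀ : IsMaximalTrio A₀ B₀ C₀ := hs.isMaximalTrio_iff.2 hmax
    have h2H : 2 ≤ #H :=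
      two_le_card_carrier hH hmax₀.isTrio (by rw [inter_eq_left.2 hAt.1]; exact hA₀) hB₀ hC₀
    let H' := hH.toAddSubgroup
    haveI : Fintype ↥H' := Fintype.ofFinite _
    have hHH' : ∀ x, x ∈ H' ↔ x ∈ H := fun x => hH.mem_toAddSubgroup
    have hcardH : Fintype.card ↥H' = #H := by
      have hHu' : toSub H' H = univ := eq_univ_of_forall fun x => mem_toSub.2 ((hHH' x).1 x.2)
      rw [← card_univ, ← hHu', card_toSub (fun y hy => (hHH' y).2 (mem_coe.1 hy))]
    have hlt : Fintype.card ↥H' < n := by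
      rw [hcardH, ← hcard, ← card_univ]
      exact card_lt_card (ssubset_of_subset_of_ne (subset_univ H) hHu)
    have hsubs := hmaxIn
    obtain ⟨hXH, hYH, hZH, -, -⟩ := hsubs
    have cv : ∀ {W : Finset G}, W ⊆ H → (W : Set G) ⊆ H' :=
      fun hW y hy => (hHH' y).2 (hW (mem_coe.1 hy))
    have ih := ihn _ hlt (↥H') rfl _ _ _ (isMaximalTrio_toSub hHH' hmaxIn)
      (by rw [trioDeficiency_toSub hHH' hXH hYH hZH, hδIn]; exact hδ)
      (toSub_nonempty (cv hXH) hA₀) (toSub_nonempty (cv hYH) hB₀) (toSub_nonempty (cv hZH) hC₀)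
    have ih' := trioKP_of_toSub (cv hXH) (cv hYH) (cv hZH) ih
    exact hs.trioKP (trioKP_of_isImpureBeatAt hH h2H hAt hmax₀ hA₀ ih')
  · obtain ⟨r, A₀, B₀, C₀, hs, hAt, hmaxIn, hA₀, hB₀, hC₀, hδIn⟩ := h.exists_continuation hH hmax
    have hmax₀ : IsMaximalTrio A₀ B₀ C₀ := hs.isMaximalTrio_iff.2 hmax
    have h2H : 2 ≤ #H := two_le_card_carrier hH hmax₀.isTrio hA₀ hB₀ hC₀
    let H' := hH.toAddSubgroup
    haveI : Fintype ↥H' := Fintype.ofFinite _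
    have hHH' : ∀ x, x ∈ H' ↔ x ∈ H := fun x => hH.mem_toAddSubgroup
    have hcardH : Fintype.card ↥H' = #H := by
      have hHu' : toSub H' H = univ := eq_univ_of_forall fun x => mem_toSub.2 ((hHH' x).1 x.2)
      rw [← card_univ, ← hHu', card_toSub (fun y hy => (hHH' y).2 (mem_coe.1 hy))]
    have hlt : Fintype.card ↥H' < n := by
      rw [hcardH, ← hcard, ← card_univ]
      exact card_lt_card (ssubset_of_subset_of_ne (subset_univ H) hHu)
    have hsubs := hmaxIn
    obtain ⟨hXH, hYH, hZH, -, -⟩ := hsubs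
    have cv : ∀ {W : Finset G}, W ⊆ H → (W : Set G) ⊆ H' :=
      fun hW y hy => (hHH' y).2 (hW (mem_coe.1 hy))
    have ih := ihn _ hlt (↥H') rfl _ _ _ (isMaximalTrio_toSub hHH' hmaxIn)
      (by rw [trioDeficiency_toSub hHH' hXH hYH hZH, hδIn]; exact hδ)
      (toSub_nonempty (cv hXH) hA₀) (toSub_nonempty (cv hYH) hB₀) (toSub_nonempty (cv hZH) hC₀)
    have ih' := trioKP_of_toSub (cv hXH) (cv hYH) (cv hZH) ih
    exact hs.trioKP (trioKP_of_isImpureChordAt hH h2H hAt hmax₀ ih')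

/-- **The Kemperman Structure Theorem, «only if» half, for an aperiodic sum** (Kemperman 1960,
Theorem 5.1, necessity — the branch «`A + B` aperiodic»; Grynkiewicz 2005 «KST I»).  Kemperman:
«Let `A`, `B` be finite non-empty subsets of `G` satisfying (1) `|A + B| ≤ |A| + |B| − 1` and (2) if
`A + B` is periodic then `ν_c(A, B) = 1` for at least one `c`.  Necessary and sufficient … is the
existence of a non-empty subset `A₁` of `A`, a non-empty subset `B₁` of `B` and a subgroup `F` of
order `|F| ≥ 2`, such that: (i) the pair `(A₁, B₁)` is elementary, each of `A₁`, `B₁` is contained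
in an `F`-coset. (ii) `σA₁ + σB₁` has `σA₁ + σB₁` as its only representation `ā + b̄`, `ā ∈ σA`,
`b̄ ∈ σB`. (iii) `A ∖ A₁ + F = A ∖ A₁`, `B ∖ B₁ + F = B ∖ B₁`. (iv) `|σA + σB| = |σA| + |σB| − 1`.»
HERE: finite abelian `G`, `|A + B| = |A| + |B| − 1`, `A + B` APERIODIC (`-- TODO(general form)`: the
branch «`A + B` periodic with a unique expression element» — Kemperman's case (i) of Lemma 5.2 via
Lemma 4.6 (i) and the remark after Lemma 4.5 —, and infinite `G`).
PROOF (ours): an aperiodic critical pair is pure, so `(A, B, \overline{−(A+B)})` is a maximal trio of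
deficiency `1` (`purePair_critical_iff_maximalTrio`), and `trioKP_of_isMaximalTrio` walks the
Boothby–DeVos–Montejano classification: pure beat → `exists_isKempermanDecompI_of_add_eq_univ_erase`
and type (I) pairs; pure chord → type (I)/(II) pairs; impure beat / impure chord → the coarse data
of each pair relative to `H` (`kp_of_subset_carrier`, `kp_of_outer_pair`, `kp_chord_inner`,
`kp_chord_outer`) + `exists_isKempermanDecompI_of_coarse_of_imp` (the lift of Kemperman's (3) with
the inheritance of (2)) + induction inside `H`, transported by `IsKempermanDecompI.of_toSub`.
[cite: Kemperman1960, Thm 5.1] [cite: Grynkiewicz2005, §2 (KST I)]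
[cite: BoothbyDevosMontejano2013, Thm 4.5] -/
theorem exists_isKempermanDecompI_of_not_isPeriodic {G : Type u} [AddCommGroup G] [Fintype G]
    [DecidableEq G] [Nontrivial G] {A B : Finset G} (hA : A.Nonempty) (hB : B.Nonempty)
    (hcrit : #(A + B) + 1 = #A + #B) (hap : ¬ IsPeriodic (A + B)) :
    ∃ (H : AddSubgroup G) (A₁ A₀ B₁ B₀ : Finset G), IsKempermanDecompI H A B A₁ A₀ B₁ B₀ := by
  have hABne : (A + B).Nonempty := hA.add hB
  have hper : (A + B).addStab = {0} := by
    by_contra h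
    exact hap ((isPeriodic_iff_addStab_ne hABne).2 h)
  have h0 : ({0} : Finset G) = 0 := Finset.singleton_zero
  have hABu : A + B ≠ univ := by
    intro hu
    refine hap ⟨⊤, ?_, fun g _ => by rw [hu]; exact vadd_finset_univ⟩
    obtain ⟨x, y, hxy⟩ := exists_pair_ne G
    intro h
    have hx : x ∈ (⊤ : AddSubgroup G) := AddSubgroup.mem_top x
    have hy : y ∈ (⊤ : AddSubgroup G) := AddSubgroup.mem_top y
    rw [h, AddSubgroup.mem_bot] at hx hy
    exact hxy (by rw [hx, hy])
  have hpure : IsPurePair A B := by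
    have := isPurePair_add_addStab hA hB
    rwa [hper, h0, add_zero, add_zero] at this
  obtain ⟨hmax, -⟩ := (purePair_critical_iff_maximalTrio hA hB).1 ⟨hpure, by omega, rfl⟩
  have hδ : trioDeficiency A B (third A B) = 1 := by
    rw [trioDeficiency_third]; omega
  have hC : (third A B).Nonempty := by
    rw [← card_pos, card_third]
    have : #(A + B) < Fintype.card G := by
      rw [← card_univ]; exact card_lt_card (ssubset_of_subset_of_ne (subset_univ _) hABu)
    omega
  exact (trioKP_of_isMaximalTrio _ G rfl A B (third A B) hmax hδ hA hB hC).1 (Or.inl hap)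

/-- The same with Kemperman's hypothesis (1) `|A + B| ≤ |A| + |B| − 1` (Kneser forces equality for an
aperiodic sum). [cite: Kemperman1960, Thm 5.1] -/
theorem exists_isKempermanDecompI_of_not_isPeriodic' {G : Type u} [AddCommGroup G] [Fintype G]
    [DecidableEq G] [Nontrivial G] {A B : Finset G} (hA : A.Nonempty) (hB : B.Nonempty)
    (hcrit : #(A + B) + 1 ≤ #A + #B) (hap : ¬ IsPeriodic (A + B)) :
    ∃ (H : AddSubgroup G) (A₁ A₀ B₁ B₀ : Finset G), IsKempermanDecompI H A B A₁ A₀ B₁ B₀ := by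
  have hABne : (A + B).Nonempty := hA.add hB
  have hper : (A + B).addStab = {0} := by
    by_contra h
    exact hap ((isPeriodic_iff_addStab_ne hABne).2 h)
  have h0 : ({0} : Finset G) = 0 := Finset.singleton_zero
  have hkn := add_kneser A B
  rw [hper, h0, add_zero, add_zero, Finset.card_zero] at hkn
  exact exists_isKempermanDecompI_of_not_isPeriodic hA hB (by omega) hap

end Main

end Literature.Combinatorics.Additive
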